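import Literature.Analysis.Matrix.TridiagonalDeterminant
import Mathlib
import HarnessLib

/-!
# Ring 2 · AbelianAll (ab-weil-1, gen 28; landed gen 29) — the Kita–Yoshida continuant: `det T_k = (1 - c₁⋯c_{k+1}) / ∏ (1 - c_j)`

research route, not a corollary; conditional on HC_CM plus one named minimal statement.
Cell line: research route conditional on HC_CM; not a corollary; Q11.4-sentence-2 already refuted in dim ≥ 3.
`HC_CM` does not occur in this file and no case of the Hodge conjecture is claimed: this is the
linear-algebra kernel (identity (B) of the unit's note `PARITY-LAW-G28.md`) behind the parity law for the Weil
discriminant of the primitive parts of cyclic covers.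

## What is PROVED here (0 sorry)

For parameters `c₁, c₂, …` in a field with `c_j ≠ 1`, the **Kita–Yoshida intersection matrix** of the
regularised intervals `(x₁,x₂), (x₂,x₃), …, (x_k,x_{k+1})` of the rank-one local system with local monodromy
`c_j` at `x_j` is the tridiagonal matrix (`d_j = c_j - 1`)

  `T_jj = -d_{j,j+1}/(d_j d_{j+1}) = (1 - c_j c_{j+1}) / ((1 - c_j)(1 - c_{j+1}))`,
  `T_{j,j+1} = 1/d_{j+1}`, `T_{j+1,j} = c_{j+1}/d_{j+1}`, all other entries `0`

(Aomoto–Kita, *Theory of Hypergeometric Functions* (2011), §2.3.3, Lemma 2.14 eq. (2.47); Kita–Yoshida,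
*Intersection theory for twisted cycles* I, Math. Nachr. 166 (1994)).  We prove the closed form of all its
leading principal minors, for ANY matrix family `M c n` whose entries are the displayed ones (hypothesis `hM`;
no constant is defined — see the design note; 0-based: row `i` ↔ interval `(x_{i+1}, x_{i+2})`, `c i` ↔ `c_{i+1}`):

* `det_kyMatrix` : `(M c n).det = (1 - ∏_{i ≤ n} c i) / ∏_{i ≤ n} (1 - c i)`  (all `n`, all fields),
* `det_kyMatrix_explicit` : the same for the literal `Matrix.of` term (hypothesis-free apart from `c i ≠ 1`),
* `det_kyMatrix_mul_prod` : the division-free form `det · ∏ (1 - c i) = 1 - ∏ c i`,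
* `det_kyMatrix_of_prod_eq` : if moreover `c 0 ⋯ c n · c∞ = 1` (the product of ALL local monodromies is `1`,
  `c∞` the one at the deleted point) then `det · ∏_{i ≤ n} (1 - c i) = 1 - c∞⁻¹`, i.e. up to the rational/positive
  factors handled in the note the determinant is `(1 - c̄∞)` — the shape used for the norm-class computation
  `disc = [(-1)^{n'} ∏ (1 - ζ^{a_j})]`.

The proof is the continuant recurrence `Literature.Analysis.Matrix.det_tridiagonal_eq` (expansion along the first
row) plus the polynomial identity `(1 - c₀c₁)(1 - c₁Q) - c₁(1 - c₀)(1 - Q) = (1 - c₁)(1 - c₀c₁Q)`.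
Nothing here is specific to abelian varieties; the file is placed with the unit's other Ring-2 AbelianAll files
because it is the certificate behind that cell's parity law (the matrix itself is the cited published object;
the closed form of its determinant for general exponents is, as far as the unit's literature search found, not
stated in print — Yoshida's "Determinant formulae" (Math. Nachr. 214, 2000) is requested, acq-09454).
[cite: AomotoKita2011, §2.3.3 Lemma 2.14 (2.47) and Lemma 2.9(4)] [folklore]
-/

set_option linter.dupNamespace false

namespace Summit.HodgeConjecture.HodgeConjecture.Ring2.AbelianAll

open Finset
open _root_.Matrix

section KYContinuant

variable {F : Type*} [Field F]

/-
DESIGN NOTE (no new definitions).  To keep this helper file definition-free (new `def`s under `Theorems/`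
are review-queued, D-0009), the Kita–Yoshida matrix is not introduced as a constant: every theorem of the
section takes an arbitrary family of square matrices `M c n` together with the hypothesis `hM` that its entries
ARE the Kita–Yoshida entries, and the closing theorem `det_kyMatrix_explicit` instantiates `M` with the literal
`Matrix.of` term (hypothesis discharged by `rfl`).  Readers should think `M c n = kyMatrix c n`, 0-based:
row `i` ↔ interval `(x_{i+1}, x_{i+2})`, `c i` ↔ `c_{i+1}`; diagonal `(1 - c i * c (i+1)) / ((1 - c i) * (1 - c (i+1)))`,
superdiagonal `(i, i+1) ↦ 1 / (c (i+1) - 1)`, subdiagonal `(j+1, j) ↦ c (j+1) / (c (j+1) - 1)`, zero elsewhere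
[cite: AomotoKita2011, §2.3.3].
-/

variable (M : (ℕ → F) → (n : ℕ) → Matrix (Fin n) (Fin n) F)
  (hM : ∀ (c : ℕ → F) (n : ℕ) (i j : Fin n), M c n i j =
    if (j : ℕ) = i then (1 - c i * c (i + 1)) / ((1 - c i) * (1 - c (i + 1)))
    else if (j : ℕ) = i + 1 then 1 / (c (i + 1) - 1)
    else if (i : ℕ) = j + 1 then c i / (c i - 1)
    else 0)
include hM

/-- A Kita–Yoshida matrix family is tridiagonal. -/
theorem kyMatrix_tridiagonal (c : ℕ → F) (n : ℕ) :
    ∀ i j : Fin n, (i : ℕ) + 1 < j ∨ (j : ℕ) + 1 < i → M c n i j = 0 := by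
  intro i j h
  rw [hM, if_neg (by omega), if_neg (by omega), if_neg (by omega)]

/-- The trailing principal submatrix of `M c (n+1)` is the Kita–Yoshida matrix of the shifted parameters. -/
theorem kyMatrix_submatrix_succ (c : ℕ → F) (n : ℕ) :
    (M c (n + 1)).submatrix Fin.succ Fin.succ = M (fun k => c (k + 1)) n := by
  ext i j
  simp only [Matrix.submatrix_apply, hM, Fin.val_succ]
  split_ifs <;> first | rfl | (exfalso; omega)

/-- The principal submatrix of `M c (n+2)` obtained by deleting the first two rows and columns is the
Kita–Yoshida matrix of the twice-shifted parameters. -/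
theorem kyMatrix_submatrix_succ_succ (c : ℕ → F) (n : ℕ) :
    (M c (n + 1 + 1)).submatrix (Fin.succ ∘ Fin.succ) (Fin.succ ∘ Fin.succ) =
      M (fun k => c (k + 1 + 1)) n := by
  rw [← Matrix.submatrix_submatrix, kyMatrix_submatrix_succ M hM, kyMatrix_submatrix_succ M hM]

/-- **Identity (B): the Kita–Yoshida continuant.** For `c i ≠ 1` (`i ≤ n`),
`det (M c n) = (1 - c 0 ⋯ c n) / ((1 - c 0) ⋯ (1 - c n))` for any Kita–Yoshida matrix family `M`. [folklore] -/
theorem det_kyMatrix : ∀ (n : ℕ) (c : ℕ → F), (∀ i ≤ n, c i ≠ 1) →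
    (M c n).det = (1 - ∏ i ∈ range (n + 1), c i) / ∏ i ∈ range (n + 1), (1 - c i) := by
  intro n
  induction n using Nat.strong_induction_on with
  | _ n ih =>
  intro c hc
  rcases n with _ | _ | m
  · -- size 0: `det = 1 = (1 - c 0)/(1 - c 0)`
    have h0 : (1 : F) - c 0 ≠ 0 := sub_ne_zero.mpr (hc 0 le_rfl).symm
    simp [Matrix.det_isEmpty, h0]
  · -- size 1
    simp [Matrix.det_unique, hM, Finset.prod_range_succ]
  · -- size m+2: continuant recurrence along row 0
    have h0 : (1 : F) - c 0 ≠ 0 := sub_ne_zero.mpr (hc 0 (by omega)).symm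
    have h1 : (1 : F) - c 1 ≠ 0 := sub_ne_zero.mpr (hc 1 (by omega)).symm
    have h1' : c 1 - (1 : F) ≠ 0 := sub_ne_zero.mpr (hc 1 (by omega))
    have hQ : ∏ i ∈ range (m + 1), (1 - c (i + 1 + 1)) ≠ 0 :=
      Finset.prod_ne_zero_iff.mpr fun i hi =>
        sub_ne_zero.mpr (hc (i + 1 + 1) (by simp at hi; omega)).symm
    have hrec := Literature.Analysis.Matrix.det_tridiagonal_eq (m := m) (R := F)
      (M c (m + 1 + 1)) (kyMatrix_tridiagonal M hM c (m + 1 + 1))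
    rw [hrec, kyMatrix_submatrix_succ_succ M hM, kyMatrix_submatrix_succ M hM,
      ih (m + 1) (by omega) (fun k => c (k + 1)) (fun i hi => hc (i + 1) (by omega)),
      ih m (by omega) (fun k => c (k + 1 + 1)) (fun i hi => hc (i + 1 + 1) (by omega))]
    have e00 : M c (m + 1 + 1) 0 0 = (1 - c 0 * c 1) / ((1 - c 0) * (1 - c 1)) := by
      simp [hM]
    have e01 : M c (m + 1 + 1) 0 1 = 1 / (c 1 - 1) := by
      simp [hM]
    have e10 : M c (m + 1 + 1) 1 0 = c 1 / (c 1 - 1) := by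
      simp [hM]
    rw [e00, e01, e10]
    have hP : ∏ i ∈ range (m + 1 + 1 + 1), c i = c 0 * (c 1 * ∏ i ∈ range (m + 1), c (i + 1 + 1)) := by
      rw [Finset.prod_range_succ', Finset.prod_range_succ']
      simp only [zero_add]
      ring
    have hPi : ∏ i ∈ range (m + 1 + 1 + 1), (1 - c i) =
        (1 - c 0) * ((1 - c 1) * ∏ i ∈ range (m + 1), (1 - c (i + 1 + 1))) := by
      rw [Finset.prod_range_succ', Finset.prod_range_succ']
      simp only [zero_add]
      ring
    have hP1 : ∏ i ∈ range (m + 1 + 1), c (i + 1) = c 1 * ∏ i ∈ range (m + 1), c (i + 1 + 1) := by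
      rw [Finset.prod_range_succ']
      simp only [zero_add]
      ring
    have hPi1 : ∏ i ∈ range (m + 1 + 1), (1 - c (i + 1)) =
        (1 - c 1) * ∏ i ∈ range (m + 1), (1 - c (i + 1 + 1)) := by
      rw [Finset.prod_range_succ']
      simp only [zero_add]
      ring
    simp only [hP, hPi, hP1, hPi1]
    field_simp
    ring

/-- Division-free form of `det_kyMatrix`: `det (M c n) * ∏_{i ≤ n} (1 - c i) = 1 - ∏_{i ≤ n} c i`. -/
theorem det_kyMatrix_mul_prod (n : ℕ) (c : ℕ → F) (hc : ∀ i ≤ n, c i ≠ 1) :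
    (M c n).det * ∏ i ∈ range (n + 1), (1 - c i) = 1 - ∏ i ∈ range (n + 1), c i := by
  have hPi : ∏ i ∈ range (n + 1), (1 - c i) ≠ 0 :=
    Finset.prod_ne_zero_iff.mpr fun i hi => sub_ne_zero.mpr (hc i (by simp at hi; omega)).symm
  rw [det_kyMatrix M hM n c hc, div_mul_cancel₀ _ hPi]

/-- The shape used for the Weil discriminant: if the local monodromies multiply to one,
`c 0 ⋯ c n * cinf = 1` (`cinf` = the monodromy at the point sent to infinity), then
`det (M c n) * ∏_{i ≤ n} (1 - c i) = 1 - cinf⁻¹`. -/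
theorem det_kyMatrix_of_prod_eq (n : ℕ) (c : ℕ → F) (cinf : F) (hc : ∀ i ≤ n, c i ≠ 1)
    (hprod : (∏ i ∈ range (n + 1), c i) * cinf = 1) :
    (M c n).det * ∏ i ∈ range (n + 1), (1 - c i) = 1 - cinf⁻¹ := by
  rw [det_kyMatrix_mul_prod M hM n c hc, ← eq_inv_of_mul_eq_one_left hprod]

omit hM in
/-- **Identity (B), explicit form.** The determinant of the literal `n × n` Kita–Yoshida matrix
(`Matrix.of` of the entry formula) is `(1 - c 0 ⋯ c n) / ((1 - c 0) ⋯ (1 - c n))` whenever `c i ≠ 1` for `i ≤ n`.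
[cite: AomotoKita2011, §2.3.3 Lemma 2.14 (2.47)] [folklore] -/
theorem det_kyMatrix_explicit (n : ℕ) (c : ℕ → F) (hc : ∀ i ≤ n, c i ≠ 1) :
    (Matrix.of fun i j : Fin n =>
        if (j : ℕ) = i then (1 - c i * c (i + 1)) / ((1 - c i) * (1 - c (i + 1)))
        else if (j : ℕ) = i + 1 then 1 / (c (i + 1) - 1)
        else if (i : ℕ) = j + 1 then c i / (c i - 1)
        else 0).det = (1 - ∏ i ∈ range (n + 1), c i) / ∏ i ∈ range (n + 1), (1 - c i) :=
  det_kyMatrix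
    (fun c n => Matrix.of fun i j : Fin n =>
        if (j : ℕ) = i then (1 - c i * c (i + 1)) / ((1 - c i) * (1 - c (i + 1)))
        else if (j : ℕ) = i + 1 then 1 / (c (i + 1) - 1)
        else if (i : ℕ) = j + 1 then c i / (c i - 1)
        else 0)
    (fun _ _ _ _ => rfl) n c hc

end KYContinuant

end Summit.HodgeConjecture.HodgeConjecture.Ring2.AbelianAll
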